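import Mathlib
import HarnessLib
import Summits.HubbardSuperconductivity.HubbardSuperconductivity.Theorems.KLProgrammeKLRegimeSplitTwoLegSizesMSWithPiecesL
import Summits.HubbardSuperconductivity.HubbardSuperconductivity.Theorems.KLProgrammeKLRegimeSplitBundleV15

/-!
# Route `KLProgramme`, crux K3 — gen-6 ENGINE child (`KLRegimeEngineV15`, bundle `klPredsV15`): the (E3a-MS-TQ) supplier theorems
# `TwoLegSizesMSTQ` (`msBarQ`-keyed slot, plan g14 (R12) T1b), DEPTH-GRADED, low-part totals as hypotheses (MS-A34, MS-A0, MS-A34-ter)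

Seat hubbard-kl-k3c3-p1 (g4).  The gen-6 two-leg slot `TwoLegStepV15` (`…SplitBundleV15`) reads the multi-slot sizes as `TwoLegSizesMSTQ L M G Q R β U μ K n`
= `TwoLegSizesMSFnQ … K.eval n` = the l.312 text of `…SplitFrameFn` with the slot allowance `msBarQ G Q U n · (Gfr j · uPow j U · 4^{(j−2)m})`,
`msBarQ G Q U n = Q.CE · twoLegBar G Q U 1 n`.  This file keys the budget-parametric, depth-graded supplier chain of this generation
(`…TwoLegSizesMSWith` → `…MSWithChain` → `…MSProfileOsc` → `…MSChainTableGraded`/`…TableFrames` → `…MSWithPieces`/`…MSWithPiecesL`) to that text: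

* `twoLegSizesMSFnQ_iff_with` / `twoLegSizesMSTQ_iff_with` (`Iff.rfl`), `TwoLegSizesMSWith.toMSFnQ` / `.toMSTQ` (monotonicity + the two fits);
* **`twoLegSizesMSTQ_succ_of_pieces`** (scale `n+1 ≤ nScales β`), **`twoLegSizesMSTQ_zero_of_pieces`** (scale `0`), **`twoLegSizesMSTQ_top_of_frameOK`**
  (scale `nScales β + 1`): binders = the regime (`c ≤ klCurveC3 R/16`, `U ≤ klCurveU0 R/16`; top: `/1`), the pieces `Kp` of `K` (`FrameOK`'s `∃ Kp`
  opened — from the stub's `FrameOKDeg … K` take `.1`), the engine's exports (`S`, `σ`, `ε`, continuity, `X`) exactly as in the MS-SUPPLIER-SHEET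
  (evidence #35 on stmt-…-19918), the LOW-PART TOTALS `hΛ₃`/`hΛ₄` (MS-A34-ter: `Σ_{m′ ∈ Ioc n₀ N} ‖D³ᐟ⁴ evalM (lowPart d (Kp m′))‖ ≤ Λ₃ᐟ₄` — to be
  discharged by the mixed Jackson–Bernstein low-part bound with `Λ₄ ≍ Gfr₁U²16^{n₀}`; the sup-Bernstein totals of `…MSWithPieces` are a valid but
  order-4-vacuous instance), and the two FITS, depth-graded, oscillation entries, by name:
  `hfit_n : ∀ j ≤ 4, msPieceBaseL X σ R U n₀ Λ₃ Λ₄ j ≤ twoLegBar G Q U j n₀`,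
  `hfit_m : ∀ m ∈ Ioc n₀ N, ∀ j ≤ 4, msPieceSlotL X σ ε R c U d n₀ Λ₃ Λ₄ m j ≤ msBarQ G Q U n₀ · (Gfr j · uPow j U · 4^{(j−2)m})`
  (`msPieceBaseL_eq` / `msPieceSlotL_eq` unfold them; their arithmetic discharge — symbolic in `A₃ = msA3L …`, `A₄ = msA4L …` — is k3c3-p3's
  `…TwoLegSizesMSFit*`, which fixes the ONE inequality on `Q.CE` / `G.S` the registrant needs).

Proofs only; nothing about the model.
-/

noncomputable section

namespace Summit.HubbardSuperconductivity.HubbardSuperconductivity.Theorems.KLRegimeSplit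

set_option linter.dupNamespace false -- summit = problem name (single-conjunct summit), D-0017
set_option maxSynthPendingDepth 4 -- nested operator-norm instances (symbol sizes up to order five), as in `…CompDiff`

open Real Finset Literature.MathematicalPhysics.QuantumLattice Literature.MathematicalPhysics.QuantumLattice.FermiRG
open Literature.MathematicalPhysics.QuantumLattice.BandSectorCounting
open Summit.HubbardSuperconductivity.HubbardSuperconductivity.Theorems.KLProgrammeLegKernels
open Summit.HubbardSuperconductivity.HubbardSuperconductivity.Theorems.DispersionFlow
open Summit.HubbardSuperconductivity.HubbardSuperconductivity.Theorems.PerturbedFermiCurve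

section MS

variable {L M : ℕ} [NeZero L] [NeZero M] {G : GeoConsts} {Q : EngConsts} {R : RenConsts} {β U μ : ℝ}

/-! ## §1 The `Q`-keyed slot text is an instance of the parametric one -/

/-- **`TwoLegSizesMSFnQ` is the instance `b = twoLegBar … · n`, `B m j = msBarQ … n · (Gfr j · uPow j U · 4^{(j−2)m})`** (by `Iff.rfl`). -/
theorem twoLegSizesMSFnQ_iff_with (K : FrameFn) (n : ℕ) :
    TwoLegSizesMSFnQ L M G Q R β U μ K n ↔ TwoLegSizesMSWith L M β U μ K n (fun j => twoLegBar G Q U j n)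
      (fun m j => msBarQ G Q U n * (R.Gfr j * uPow j U * (4 : ℝ) ^ (((j : ℤ) - 2) * m))) :=
  Iff.rfl

/-- The same at `K.eval` (the gen-6 slot text `TwoLegSizesMSTQ`). -/
theorem twoLegSizesMSTQ_iff_with (K : TrigPolyC4v) (n : ℕ) :
    TwoLegSizesMSTQ L M G Q R β U μ K n ↔ TwoLegSizesMSWith L M β U μ K.eval n (fun j => twoLegBar G Q U j n)
      (fun m j => msBarQ G Q U n * (R.Gfr j * uPow j U * (4 : ℝ) ^ (((j : ℤ) - 2) * m))) :=
  Iff.rfl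

/-- From the parametric text with the `msBarQ` fits to `TwoLegSizesMSFnQ`. -/
theorem TwoLegSizesMSWith.toMSFnQ {K : FrameFn} {n : ℕ} {b : ℕ → ℝ} {B : ℕ → ℕ → ℝ}
    (h : TwoLegSizesMSWith L M β U μ K n b B) (hb : ∀ j ≤ 4, b j ≤ twoLegBar G Q U j n)
    (hB : ∀ m ∈ Ioc n (nScales β), ∀ j ≤ 4, B m j ≤ msBarQ G Q U n * (R.Gfr j * uPow j U * (4 : ℝ) ^ (((j : ℤ) - 2) * m))) :
    TwoLegSizesMSFnQ L M G Q R β U μ K n :=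
  (twoLegSizesMSFnQ_iff_with K n).2 (h.mono hb hB)

/-- From the parametric text at `K.eval` with the `msBarQ` fits to `TwoLegSizesMSTQ`. -/
theorem TwoLegSizesMSWith.toMSTQ {K : TrigPolyC4v} {n : ℕ} {b : ℕ → ℝ} {B : ℕ → ℕ → ℝ}
    (h : TwoLegSizesMSWith L M β U μ K.eval n b B) (hb : ∀ j ≤ 4, b j ≤ twoLegBar G Q U j n)
    (hB : ∀ m ∈ Ioc n (nScales β), ∀ j ≤ 4, B m j ≤ msBarQ G Q U n * (R.Gfr j * uPow j U * (4 : ℝ) ^ (((j : ℤ) - 2) * m))) :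
    TwoLegSizesMSTQ L M G Q R β U μ K n :=
  h.toMSFnQ hb hB

/-! ## §2 The three (E3a-MS-TQ) supplier theorems -/

/-- **(E3a-MS-TQ) AT SCALE `n+1` IN THE KL REGIME, KEYED BY THE ADMISSIBLE PIECES** (low-part totals `Λ₃, Λ₄` as hypotheses; depth-graded,
oscillation-entry fits).  See the module docstring. -/
theorem twoLegSizesMSTQ_succ_of_pieces (hR : ∀ j, 0 ≤ R.Gfr j) {c : ℝ} (hc : 0 < c) (hcle : c ≤ klCurveC3 R / 16)
    (hU : 0 < U) (hUle : U ≤ klCurveU0 R / 16) (hβmin : klBetaMin ≤ β) (hβc : β ≤ Real.exp (c / U ^ 2)) (hμ : μ ∈ klWindowC)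
    {K : TrigPolyC4v} {Kp : ℕ → TrigPolyC4v} (hK : ∀ p : Fin 2 → ℝ, K.eval p = ∑ m ∈ range (nScales β + 1), (Kp m).eval p)
    (ha : ∀ m ≤ nScales β, ∀ j ≤ 4, ∀ q : Momentum, ‖iteratedFDeriv ℝ j (evalM (Kp m)) q‖ ≤ pieceSize R U m j)
    {n : ℕ} (hn : n + 1 ≤ nScales β) (d : ℕ)
    {Λ₃ : ℝ} (hΛ₃ : ∀ q : Momentum, ∑ m ∈ Ioc (n + 1) (nScales β), ‖iteratedFDeriv ℝ 3 (evalM (lowPart d (Kp m))) q‖ ≤ Λ₃)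
    {Λ₄ : ℝ} (hΛ₄ : ∀ q : Momentum, ∑ m ∈ Ioc (n + 1) (nScales β), ‖iteratedFDeriv ℝ 4 (evalM (lowPart d (Kp m))) q‖ ≤ Λ₄)
    (hc₁ : Continuous (klLocalPart L M β U μ K (n + 1))) (hc₀ : Continuous (klLocalPart L M β U μ K n))
    {S : ℕ → TrigPolyC4v}
    (hS : ∀ θ, klLocalPart L M β U μ K (n + 1) θ - klLocalPart L M β U μ K n θ =
      (S (nScales β - (n + 1))).eval (klFermiPoint μ K θ))
    {σ : ℕ → ℕ → ℝ} (hσnn : ∀ k l, 0 ≤ σ k l)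
    (hσ0 : ∀ k ≤ nScales β - (n + 1), ∀ q : Momentum, |evalM (S k) q| ≤ σ k 0)
    (hσ : ∀ k ≤ nScales β - (n + 1), ∀ l, 1 ≤ l → l ≤ 5 → ∀ q : Momentum, ‖iteratedFDeriv ℝ l (evalM (S k)) q‖ ≤ σ k l)
    {ε : ℕ → ℕ → ℝ} (hεnn : ∀ m l, 0 ≤ ε m l)
    (hε0 : ∀ m ∈ Ioc (n + 1) (nScales β), ∀ q : Momentum, |evalM (fsub (S (m - (n + 1))) (S (m - (n + 1) - 1))) q| ≤ ε m 0)
    (hε : ∀ m ∈ Ioc (n + 1) (nScales β), ∀ l, 1 ≤ l → l ≤ 4 → ∀ q : Momentum,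
      ‖iteratedFDeriv ℝ l (evalM (fsub (S (m - (n + 1))) (S (m - (n + 1) - 1)))) q‖ ≤ ε m l)
    {X : ℝ} (hX : ∀ l ≤ 4, ∀ x : ℝ, ‖iteratedFDeriv ℝ l salmhoferCutoff x‖ ≤ X)
    (hfit_n : ∀ j ≤ 4, msPieceBaseL X σ R U (n + 1) Λ₃ Λ₄ j ≤ twoLegBar G Q U j (n + 1))
    (hfit_m : ∀ m ∈ Ioc (n + 1) (nScales β), ∀ j ≤ 4,
      msPieceSlotL X σ ε R c U d (n + 1) Λ₃ Λ₄ m j ≤ msBarQ G Q U (n + 1) * (R.Gfr j * uPow j U * (4 : ℝ) ^ (((j : ℤ) - 2) * m))) :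
    TwoLegSizesMSTQ L M G Q R β U μ K (n + 1) :=
  (twoLegSizesMSWith_succ_of_pieces_L hR hc hcle hU hUle hβmin hβc hμ hK ha hn d hΛ₃ hΛ₄ hc₁ hc₀ hS hσnn hσ0 hσ hεnn hε0 hε hX).toMSTQ
    hfit_n hfit_m

/-- **(E3a-MS-TQ) AT SCALE `0` IN THE KL REGIME, KEYED BY THE ADMISSIBLE PIECES** (low-part totals `Λ₃, Λ₄` as hypotheses). -/
theorem twoLegSizesMSTQ_zero_of_pieces (hR : ∀ j, 0 ≤ R.Gfr j) {c : ℝ} (hc : 0 < c) (hcle : c ≤ klCurveC3 R / 16)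
    (hU : 0 < U) (hUle : U ≤ klCurveU0 R / 16) (hβmin : klBetaMin ≤ β) (hβc : β ≤ Real.exp (c / U ^ 2)) (hμ : μ ∈ klWindowC)
    {K : TrigPolyC4v} {Kp : ℕ → TrigPolyC4v} (hK : ∀ p : Fin 2 → ℝ, K.eval p = ∑ m ∈ range (nScales β + 1), (Kp m).eval p)
    (ha : ∀ m ≤ nScales β, ∀ j ≤ 4, ∀ q : Momentum, ‖iteratedFDeriv ℝ j (evalM (Kp m)) q‖ ≤ pieceSize R U m j)
    (d : ℕ)
    {Λ₃ : ℝ} (hΛ₃ : ∀ q : Momentum, ∑ m ∈ Ioc 0 (nScales β), ‖iteratedFDeriv ℝ 3 (evalM (lowPart d (Kp m))) q‖ ≤ Λ₃)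
    {Λ₄ : ℝ} (hΛ₄ : ∀ q : Momentum, ∑ m ∈ Ioc 0 (nScales β), ‖iteratedFDeriv ℝ 4 (evalM (lowPart d (Kp m))) q‖ ≤ Λ₄)
    (hc₀ : Continuous (klLocalPart L M β U μ K 0))
    {S : ℕ → TrigPolyC4v}
    (hS : ∀ θ, klLocalPart L M β U μ K 0 θ - K.eval (klFermiPoint μ K θ) = (S (nScales β)).eval (klFermiPoint μ K θ))
    {σ : ℕ → ℕ → ℝ} (hσnn : ∀ k l, 0 ≤ σ k l)
    (hσ0 : ∀ k ≤ nScales β, ∀ q : Momentum, |evalM (S k) q| ≤ σ k 0)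
    (hσ : ∀ k ≤ nScales β, ∀ l, 1 ≤ l → l ≤ 5 → ∀ q : Momentum, ‖iteratedFDeriv ℝ l (evalM (S k)) q‖ ≤ σ k l)
    {ε : ℕ → ℕ → ℝ} (hεnn : ∀ m l, 0 ≤ ε m l)
    (hε0 : ∀ m ∈ Ioc 0 (nScales β), ∀ q : Momentum, |evalM (fsub (S m) (S (m - 1))) q| ≤ ε m 0)
    (hε : ∀ m ∈ Ioc 0 (nScales β), ∀ l, 1 ≤ l → l ≤ 4 → ∀ q : Momentum,
      ‖iteratedFDeriv ℝ l (evalM (fsub (S m) (S (m - 1)))) q‖ ≤ ε m l)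
    {X : ℝ} (hX : ∀ l ≤ 4, ∀ x : ℝ, ‖iteratedFDeriv ℝ l salmhoferCutoff x‖ ≤ X)
    (hfit_n : ∀ j ≤ 4, msPieceBaseL X σ R U 0 Λ₃ Λ₄ j ≤ twoLegBar G Q U j 0)
    (hfit_m : ∀ m ∈ Ioc 0 (nScales β), ∀ j ≤ 4,
      msPieceSlotL X σ ε R c U d 0 Λ₃ Λ₄ m j ≤ msBarQ G Q U 0 * (R.Gfr j * uPow j U * (4 : ℝ) ^ (((j : ℤ) - 2) * m))) :
    TwoLegSizesMSTQ L M G Q R β U μ K 0 :=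
  (twoLegSizesMSWith_zero_of_pieces_L hR hc hcle hU hUle hβmin hβc hμ hK ha d hΛ₃ hΛ₄ hc₀ hS hσnn hσ0 hσ hεnn hε0 hε hX).toMSTQ
    hfit_n hfit_m

/-- **(E3a-MS-TQ) AT THE TOP SCALE IN THE KL REGIME** (`FrameOK`-keyed, thresholds `klCurveC3 R`, `klCurveU0 R`; one symbol; no slots). -/
theorem twoLegSizesMSTQ_top_of_frameOK (hR : ∀ j, 0 ≤ R.Gfr j) {c : ℝ} (hc : 0 < c) (hcle : c ≤ klCurveC3 R)
    (hU : 0 < U) (hUle : U ≤ klCurveU0 R) (hβmin : klBetaMin ≤ β) (hβc : β ≤ Real.exp (c / U ^ 2)) (hμ : μ ∈ klWindowC)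
    {K : TrigPolyC4v} (hK : FrameOK R U (nScales β) μ K)
    (hc₁ : Continuous (klLocalPart L M β U μ K (nScales β + 1))) (hc₀ : Continuous (klLocalPart L M β U μ K (nScales β)))
    {S : TrigPolyC4v}
    (hS : ∀ θ, klLocalPart L M β U μ K (nScales β + 1) θ - klLocalPart L M β U μ K (nScales β) θ = S.eval (klFermiPoint μ K θ))
    {σ : ℕ → ℝ} (hσnn : ∀ l, 0 ≤ σ l) (hσ0 : ∀ q : Momentum, |evalM S q| ≤ σ 0)
    (hσ : ∀ l, 1 ≤ l → l ≤ 4 → ∀ q : Momentum, ‖iteratedFDeriv ℝ l (evalM S) q‖ ≤ σ l)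
    {X : ℝ} (hX : ∀ l ≤ 4, ∀ x : ℝ, ‖iteratedFDeriv ℝ l salmhoferCutoff x‖ ≤ X)
    (hfit : ∀ j ≤ 4, msPieceTop X σ R U (nScales β) j ≤ twoLegBar G Q U j (nScales β + 1)) :
    TwoLegSizesMSTQ L M G Q R β U μ K (nScales β + 1) :=
  (twoLegSizesMSWith_top_of_frameOK hR hc hcle hU hUle hβmin hβc hμ hK hc₁ hc₀ hS hσnn hσ0 hσ hX
    (fun m j => msBarQ G Q U (nScales β + 1) * (R.Gfr j * uPow j U * (4 : ℝ) ^ (((j : ℤ) - 2) * m)))).toMSTQ hfit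
    (fun _ _ _ _ => le_rfl)

end MS

end Summit.HubbardSuperconductivity.HubbardSuperconductivity.Theorems.KLRegimeSplit

end
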